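import Mathlib
import HarnessLib
import Literature.Analysis.FluidPDE.TsaiMaximumPrinciple
import Summits.NavierStokesRegularity.NavierStokesRegularity.Theorems.PoloidalWindowDoorPoloidalWindowRigidityConstantShearSlice

/-!
# Item `LrcModEntire` (stmt-NavierStokesRegularity-20428), skeleton twist_split v6 — cell T1 step (I), planar Liouville package, lemma (L2):
# **a `C²` solution of `Δψ = λψ` (`λ > 0`) on `ℝ³` with bounded gradient vanishes identically** (cosh barrier + weak maximum principle)

Cell ns-regularity-ideate, LEAD ns-poloidal-K2-p3 g13 (`--supports stmt-NavierStokesRegularity-20428`; CELLS-TH-g13 §2ter, item (L2) of the Lean plan for step (I)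
of the T1 kill plan; the plane version is the `x₂`-independent special case).  Pure analysis:

* `hasFDerivAt_coshCoord`, `fderiv_coshSum_apply`, `fderiv_fderiv_coshSum_apply`, `contDiff_coshSum`, `laplacian_coshSum` — the barrier
  `H(y) = Σ_k cosh(a (y_k − c_k))` has `ΔH = a² H` (coordinate second derivatives; `…ConstantShearSlice.laplacian_eq_sum_fderiv_fderiv`);
* `exists_coord_ge_of_norm_eq` — on the sphere `‖y − c‖ = R` some coordinate has `|y_k − c_k| ≥ R/√3`, so `H ≥ cosh(aR/√3)` there;
* `le_barrier_of_massive` — weak maximum principle: `Δψ = λψ`, `ψ ≤ M` (`M ≥ 0`) on the closed ball ⇒ `ψ(c) ≤ 3M / cosh(√λ R/√3)` (at an interior positive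
  maximum of `w = ψ − (M/L)H` one would have `Δw ≤ 0` (`laplacian_nonpos_of_isLocalMax`) but `Δw = λw > 0`);
* `massiveLiouville` — **`ψ ∈ C²(ℝ³)`, `Δψ = λψ` with `λ > 0`, `‖Dψ‖ ≤ G` ⇒ `ψ ≡ 0`** (`M = ψ(c)⁺ + GR` and `R → ∞`; then the same for `−ψ`).

WHAT THIS IS NOT: not a claim about Navier–Stokes regularity (bears_on LADDER-NS N0, item 20428 / crux 19708; OPEN).
-/

noncomputable section

-- the summit and its single sub-problem share the name (CONVENTIONS §1), as in every Theorems file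
set_option linter.dupNamespace false

namespace Summit.NavierStokesRegularity.NavierStokesRegularity.Theorems.PoloidalWindowDoorLrcModEntireTwistingTHMassiveLiouville

open Set Function Filter Topology Metric InnerProductSpace
open scoped RealInnerProductSpace InnerProductSpace Laplacian ContDiff
open Literature.Analysis Literature.Analysis.FluidPDE
open Summit.NavierStokesRegularity.NavierStokesRegularity.Theorems.PoloidalWindowDoorPoloidalWindowRigidityConstantShearSlice

/-! ## 1. The cosh barrier -/

/-- Derivative of one summand `y ↦ cosh(a (y_k − c_k))`. -/
theorem hasFDerivAt_coshCoord (a : ℝ) (c : EuclideanSpace ℝ (Fin 3)) (k : Fin 3) (y : EuclideanSpace ℝ (Fin 3)) :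
    HasFDerivAt (fun y : EuclideanSpace ℝ (Fin 3) => Real.cosh (a * (y k - c k)))
      (Real.sinh (a * (y k - c k)) • (a • (EuclideanSpace.proj (𝕜 := ℝ) k : EuclideanSpace ℝ (Fin 3) →L[ℝ] ℝ))) y := by
  have hg : HasFDerivAt (fun y : EuclideanSpace ℝ (Fin 3) => a * (y k - c k))
      (a • (EuclideanSpace.proj (𝕜 := ℝ) k : EuclideanSpace ℝ (Fin 3) →L[ℝ] ℝ)) y := by
    have h1 : HasFDerivAt (fun y : EuclideanSpace ℝ (Fin 3) => y k - c k)
        (EuclideanSpace.proj (𝕜 := ℝ) k : EuclideanSpace ℝ (Fin 3) →L[ℝ] ℝ) y :=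
      (EuclideanSpace.proj (𝕜 := ℝ) k).hasFDerivAt.sub_const (c k)
    exact h1.const_mul a
  exact (Real.hasDerivAt_cosh _).comp_hasFDerivAt y hg

/-- Derivative of one summand `y ↦ sinh(a (y_k − c_k))`. -/
theorem hasFDerivAt_sinhCoord (a : ℝ) (c : EuclideanSpace ℝ (Fin 3)) (k : Fin 3) (y : EuclideanSpace ℝ (Fin 3)) :
    HasFDerivAt (fun y : EuclideanSpace ℝ (Fin 3) => Real.sinh (a * (y k - c k)))
      (Real.cosh (a * (y k - c k)) • (a • (EuclideanSpace.proj (𝕜 := ℝ) k : EuclideanSpace ℝ (Fin 3) →L[ℝ] ℝ))) y := by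
  have hg : HasFDerivAt (fun y : EuclideanSpace ℝ (Fin 3) => a * (y k - c k))
      (a • (EuclideanSpace.proj (𝕜 := ℝ) k : EuclideanSpace ℝ (Fin 3) →L[ℝ] ℝ)) y := by
    have h1 : HasFDerivAt (fun y : EuclideanSpace ℝ (Fin 3) => y k - c k)
        (EuclideanSpace.proj (𝕜 := ℝ) k : EuclideanSpace ℝ (Fin 3) →L[ℝ] ℝ) y :=
      (EuclideanSpace.proj (𝕜 := ℝ) k).hasFDerivAt.sub_const (c k)
    exact h1.const_mul a
  exact (Real.hasDerivAt_sinh _).comp_hasFDerivAt y hg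

/-- First coordinate derivatives of the barrier: `∂_i H(y) = a sinh(a (y_i − c_i))`. -/
theorem fderiv_coshSum_apply (a : ℝ) (c : EuclideanSpace ℝ (Fin 3)) (i : Fin 3) (y : EuclideanSpace ℝ (Fin 3)) :
    fderiv ℝ (fun y : EuclideanSpace ℝ (Fin 3) => ∑ k : Fin 3, Real.cosh (a * (y k - c k))) y (EuclideanSpace.single i (1 : ℝ)) =
      a * Real.sinh (a * (y i - c i)) := by
  have h : HasFDerivAt (fun y : EuclideanSpace ℝ (Fin 3) => ∑ k : Fin 3, Real.cosh (a * (y k - c k)))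
      (∑ k : Fin 3, Real.sinh (a * (y k - c k)) • (a • (EuclideanSpace.proj (𝕜 := ℝ) k : EuclideanSpace ℝ (Fin 3) →L[ℝ] ℝ))) y := by
    exact HasFDerivAt.fun_sum (u := Finset.univ) (fun k _ => hasFDerivAt_coshCoord a c k y)
  rw [h.fderiv]
  simp [Fin.sum_univ_three]
  fin_cases i <;> simp <;> ring

/-- Second coordinate derivatives of the barrier: `∂_i∂_i H(y) = a² cosh(a (y_i − c_i))`. -/
theorem fderiv_fderiv_coshSum_apply (a : ℝ) (c : EuclideanSpace ℝ (Fin 3)) (i : Fin 3) (y : EuclideanSpace ℝ (Fin 3)) :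
    fderiv ℝ (fun y : EuclideanSpace ℝ (Fin 3) =>
        fderiv ℝ (fun y : EuclideanSpace ℝ (Fin 3) => ∑ k : Fin 3, Real.cosh (a * (y k - c k))) y (EuclideanSpace.single i (1 : ℝ))) y
      (EuclideanSpace.single i (1 : ℝ)) = a ^ 2 * Real.cosh (a * (y i - c i)) := by
  have e : (fun y : EuclideanSpace ℝ (Fin 3) =>
      fderiv ℝ (fun y : EuclideanSpace ℝ (Fin 3) => ∑ k : Fin 3, Real.cosh (a * (y k - c k))) y (EuclideanSpace.single i (1 : ℝ))) =
      fun y => a * Real.sinh (a * (y i - c i)) := funext fun y => fderiv_coshSum_apply a c i y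
  rw [e, ((hasFDerivAt_sinhCoord a c i y).const_mul a).fderiv]
  simp
  ring

/-- The barrier is smooth. -/
theorem contDiff_coshSum (a : ℝ) (c : EuclideanSpace ℝ (Fin 3)) {n : ℕ∞} :
    ContDiff ℝ n (fun y : EuclideanSpace ℝ (Fin 3) => ∑ k : Fin 3, Real.cosh (a * (y k - c k))) := by
  refine ContDiff.sum fun k _ => ?_
  have hk : ContDiff ℝ n (fun y : EuclideanSpace ℝ (Fin 3) => y k) := (EuclideanSpace.proj (𝕜 := ℝ) k).contDiff
  exact Real.contDiff_cosh.comp (contDiff_const.mul (hk.sub contDiff_const))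

/-- **`ΔH = a² H`** for the barrier `H(y) = Σ_k cosh(a (y_k − c_k))`. -/
theorem laplacian_coshSum (a : ℝ) (c : EuclideanSpace ℝ (Fin 3)) (y : EuclideanSpace ℝ (Fin 3)) :
    (Δ (fun y : EuclideanSpace ℝ (Fin 3) => ∑ k : Fin 3, Real.cosh (a * (y k - c k)))) y =
      a ^ 2 * ∑ k : Fin 3, Real.cosh (a * (y k - c k)) := by
  rw [laplacian_eq_sum_fderiv_fderiv (contDiff_coshSum a c) y]
  simp only [fderiv_fderiv_coshSum_apply, Finset.mul_sum]

/-- On the sphere `‖y − c‖ = R` some coordinate satisfies `|y_k − c_k| ≥ R/√3`. -/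
theorem exists_coord_ge_of_norm_eq {y c : EuclideanSpace ℝ (Fin 3)} {R : ℝ} (h : ‖y - c‖ = R) :
    ∃ k : Fin 3, R / Real.sqrt 3 ≤ |y k - c k| := by
  by_contra hcon
  push Not at hcon
  have hsq : ‖y - c‖ ^ 2 = ∑ k : Fin 3, (y k - c k) ^ 2 := by
    rw [EuclideanSpace.norm_eq, Real.sq_sqrt (Finset.sum_nonneg fun k _ => by positivity)]
    simp [Real.norm_eq_abs, sq_abs]
  have h3 : (0 : ℝ) < Real.sqrt 3 := Real.sqrt_pos.2 (by norm_num)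
  have hb : ∀ k : Fin 3, (y k - c k) ^ 2 < R ^ 2 / 3 := by
    intro k
    have hk := hcon k
    have hk0 : 0 ≤ |y k - c k| := abs_nonneg _
    have h1 : |y k - c k| ^ 2 < (R / Real.sqrt 3) ^ 2 := by
      exact pow_lt_pow_left₀ hk hk0 two_ne_zero
    rw [div_pow, Real.sq_sqrt (by norm_num : (0 : ℝ) ≤ 3), sq_abs] at h1
    exact h1
  have hsum : ∑ k : Fin 3, (y k - c k) ^ 2 < R ^ 2 := by
    rw [Fin.sum_univ_three]
    have h0 := hb 0; have h1 := hb 1; have h2 := hb 2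
    linarith
  rw [← hsq, h] at hsum
  exact lt_irrefl _ hsum

/-! ## 2. The weak maximum principle with the barrier, and the Liouville theorem -/

/-- **Barrier estimate.**  If `ψ ∈ C²`, `Δψ = λψ` (`λ > 0`) and `ψ ≤ M` with `0 ≤ M` on the closed ball `‖y − c‖ ≤ R` (`R > 0`), then
`ψ(c) ≤ 3M / cosh(√λ R/√3)`. -/
theorem le_barrier_of_massive {ψ : EuclideanSpace ℝ (Fin 3) → ℝ} (hψ : ContDiff ℝ 2 ψ) {lam : ℝ} (hlam : 0 < lam)
    (heq : ∀ x, (Δ ψ) x = lam * ψ x) {c : EuclideanSpace ℝ (Fin 3)} {R M : ℝ} (hR : 0 < R) (hM : 0 ≤ M)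
    (hle : ∀ y, ‖y - c‖ ≤ R → ψ y ≤ M) :
    ψ c ≤ 3 * M / Real.cosh (Real.sqrt lam * R / Real.sqrt 3) := by
  set a : ℝ := Real.sqrt lam with ha
  have ha2 : a ^ 2 = lam := by rw [ha, Real.sq_sqrt hlam.le]
  set L : ℝ := Real.cosh (a * R / Real.sqrt 3) with hL
  have hLpos : 0 < L := Real.cosh_pos _
  set H : EuclideanSpace ℝ (Fin 3) → ℝ := fun y => ∑ k : Fin 3, Real.cosh (a * (y k - c k)) with hH
  set w : EuclideanSpace ℝ (Fin 3) → ℝ := fun y => ψ y - (M / L) * H y with hw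
  -- `w ≤ 0` on the sphere
  have hHsphere : ∀ y, ‖y - c‖ = R → L ≤ H y := by
    intro y hy
    obtain ⟨k, hk⟩ := exists_coord_ge_of_norm_eq hy
    have h1 : L ≤ Real.cosh (a * (y k - c k)) := by
      rw [hL, Real.cosh_le_cosh]
      have ha0 : 0 ≤ a := Real.sqrt_nonneg _
      rw [abs_of_nonneg (by positivity), abs_mul, abs_of_nonneg ha0]
      calc a * R / Real.sqrt 3 = a * (R / Real.sqrt 3) := by ring
        _ ≤ a * |y k - c k| := mul_le_mul_of_nonneg_left hk ha0
    have h2 : Real.cosh (a * (y k - c k)) ≤ H y := by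
      rw [hH]
      simp only
      rw [Fin.sum_univ_three]
      have c0 := Real.cosh_pos (a * (y 0 - c 0)); have c1 := Real.cosh_pos (a * (y 1 - c 1)); have c2 := Real.cosh_pos (a * (y 2 - c 2))
      fin_cases k <;> simp <;> linarith
    exact h1.trans h2
  have hwsphere : ∀ y, ‖y - c‖ = R → w y ≤ 0 := by
    intro y hy
    have h1 := hle y hy.le
    have h2 := hHsphere y hy
    have h3 : M ≤ M / L * H y := by
      rw [div_mul_eq_mul_div, le_div_iff₀ hLpos]
      exact mul_le_mul_of_nonneg_left h2 hM
    show ψ y - M / L * H y ≤ 0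
    linarith
  -- `w` is `C²` with `Δw = λ w`
  have hHc : ContDiff ℝ 2 H := contDiff_coshSum a c
  have hwc : ContDiff ℝ 2 w := hψ.sub (contDiff_const.mul hHc)
  have hΔw : ∀ y, (Δ w) y = lam * w y := by
    intro y
    have h1 : (Δ w) y = (Δ ψ) y - (Δ (fun y => (M / L) * H y)) y := by
      rw [hw]
      exact (hψ.contDiffAt.laplacian_sub (contDiff_const.mul hHc).contDiffAt)
    have h2 : (Δ (fun y => (M / L) * H y)) y = (M / L) * (Δ H) y := by
      have e : (fun y => (M / L) * H y) = (M / L) • H := by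
        funext z; simp [smul_eq_mul]
      rw [e, laplacian_smul (M / L) (hHc.contDiffAt (x := y)), smul_eq_mul]
    rw [h1, h2, heq y, hH, laplacian_coshSum a c y, ha2]
    simp only [hw]
    ring
  -- weak maximum principle on the closed ball
  have hwle : w c ≤ 0 := by
    by_contra hpos
    push Not at hpos
    obtain ⟨ystar, hymem, hymax⟩ := (isCompact_closedBall c R).exists_isMaxOn (nonempty_closedBall.2 hR.le)
      (hwc.continuous.continuousOn)
    have hstar_pos : 0 < w ystar := lt_of_lt_of_le hpos (hymax (mem_closedBall_self hR.le))
    -- the maximum point is interior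
    have hint : ‖ystar - c‖ < R := by
      rcases (mem_closedBall.1 hymem).lt_or_eq with h | h
      · rwa [dist_eq_norm] at h
      · exact absurd (hwsphere ystar (by rwa [dist_eq_norm] at h)) (not_le.2 hstar_pos)
    have hloc : IsLocalMax w ystar := by
      have hnhds : closedBall c R ∈ 𝓝 ystar :=
        mem_of_superset (Metric.ball_mem_nhds ystar (sub_pos.2 hint)) fun z hz => by
          rw [mem_closedBall, dist_eq_norm]
          rw [mem_ball, dist_eq_norm] at hz
          have := norm_sub_le_norm_sub_add_norm_sub z ystar c
          linarith
      exact Filter.eventually_of_mem hnhds fun z hz => hymax hz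
    have hΔ := laplacian_nonpos_of_isLocalMax hwc hloc
    rw [hΔw ystar] at hΔ
    nlinarith
  -- conclusion
  have hHc0 : H c = 3 := by
    rw [hH]; simp
  have : ψ c - M / L * 3 ≤ 0 := by
    have h := hwle
    simp only [hw, hHc0] at h
    exact h
  rw [hL] at this
  have e : 3 * M / Real.cosh (Real.sqrt lam * R / Real.sqrt 3) = M / Real.cosh (a * R / Real.sqrt 3) * 3 := by
    rw [ha]; ring
  rw [e]; linarith

/-- `cosh t ≥ t²/4` for `t ≥ 0`. -/
theorem sq_div_four_le_cosh {t : ℝ} (ht : 0 ≤ t) : t ^ 2 / 4 ≤ Real.cosh t := by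
  rw [Real.cosh_eq]
  have h1 := Real.quadratic_le_exp_of_nonneg ht
  have h2 := Real.exp_pos (-t)
  nlinarith

/-- **MASSIVE LIOUVILLE (L2).**  `ψ ∈ C²(ℝ³)`, `Δψ = λψ` with `λ > 0`, `‖Dψ‖ ≤ G` everywhere ⇒ `ψ ≡ 0`. -/
theorem massiveLiouville {ψ : EuclideanSpace ℝ (Fin 3) → ℝ} (hψ : ContDiff ℝ 2 ψ) {lam G : ℝ} (hlam : 0 < lam)
    (hG : ∀ x, ‖fderiv ℝ ψ x‖ ≤ G) (heq : ∀ x, (Δ ψ) x = lam * ψ x) : ∀ x, ψ x = 0 := by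
  have hG0 : 0 ≤ G := (norm_nonneg _).trans (hG 0)
  -- one-sided bound for every solution with the same data
  have key : ∀ φ : EuclideanSpace ℝ (Fin 3) → ℝ, ContDiff ℝ 2 φ → (∀ x, ‖fderiv ℝ φ x‖ ≤ G) → (∀ x, (Δ φ) x = lam * φ x) →
      ∀ c, φ c ≤ 0 := by
    intro φ hφ hφG hφeq c
    by_contra hpos
    push Not at hpos
    set η := φ c with hη
    -- gradient bound on balls: `φ y ≤ η + G R`
    have hball : ∀ R : ℝ, 0 < R → ∀ y, ‖y - c‖ ≤ R → φ y ≤ η + G * R := by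
      intro R hR y hy
      have hmv := Convex.norm_image_sub_le_of_norm_fderiv_le (f := φ) (fun z _ => (hφ.differentiable (by simp)) z)
        (fun z _ => hφG z) (convex_closedBall c R) (mem_closedBall_self hR.le) (by rwa [mem_closedBall, dist_eq_norm])
      rw [Real.norm_eq_abs] at hmv
      have h1 : φ y - φ c ≤ G * ‖y - c‖ := (le_abs_self _).trans hmv
      have h2 : G * ‖y - c‖ ≤ G * R := mul_le_mul_of_nonneg_left hy hG0
      linarith
    -- barrier estimate for every `R > 0`
    have hest : ∀ R : ℝ, 0 < R → η ≤ 3 * (η + G * R) / Real.cosh (Real.sqrt lam * R / Real.sqrt 3) := fun R hR =>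
      le_barrier_of_massive hφ hlam hφeq hR (by positivity) (hball R hR)
    -- choose `R` large
    set R : ℝ := 36 * (η + G) / (lam * η) + 1 with hRdef
    have hR1 : 1 ≤ R := by
      rw [hRdef]; have : 0 ≤ 36 * (η + G) / (lam * η) := by positivity
      linarith
    have hR : 0 < R := by linarith
    have h := hest R hR
    have hcosh : lam * R ^ 2 / 12 ≤ Real.cosh (Real.sqrt lam * R / Real.sqrt 3) := by
      have ht : 0 ≤ Real.sqrt lam * R / Real.sqrt 3 := by positivity
      have h1 := sq_div_four_le_cosh ht
      have e : (Real.sqrt lam * R / Real.sqrt 3) ^ 2 / 4 = lam * R ^ 2 / 12 := by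
        rw [div_pow, mul_pow, Real.sq_sqrt hlam.le, Real.sq_sqrt (by norm_num : (0 : ℝ) ≤ 3)]
        try ring
      linarith [e ▸ h1]
    have hcpos : 0 < Real.cosh (Real.sqrt lam * R / Real.sqrt 3) := Real.cosh_pos _
    -- `η cosh ≤ 3 (η + G R) ≤ 3 (η + G) R`
    have h2 : η * Real.cosh (Real.sqrt lam * R / Real.sqrt 3) ≤ 3 * (η + G * R) := by
      have := (le_div_iff₀ hcpos).1 h
      linarith
    have h3 : 3 * (η + G * R) ≤ 3 * (η + G) * R := by nlinarith
    have h4 : η * (lam * R ^ 2 / 12) ≤ 3 * (η + G) * R := by nlinarith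
    -- divide by `R`: `η lam R ≤ 36 (η + G)`, contradicting the choice of `R`
    have h5 : η * lam * R ≤ 36 * (η + G) := by nlinarith
    have h6 : η * lam * R = 36 * (η + G) + lam * η := by
      rw [hRdef]; field_simp
      try ring
    nlinarith [mul_pos hlam hpos]
  intro x
  have h1 := key ψ hψ hG heq x
  have h2 := key (fun y => -ψ y) hψ.neg (fun y => by
      rw [show (fun y => -ψ y) = -ψ from rfl, fderiv_neg, norm_neg]; exact hG y)
    (fun y => by
      rw [show (fun y => -ψ y) = -ψ from rfl, laplacian_neg, Pi.neg_apply, heq y]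
      ring) x
  linarith

end Summit.NavierStokesRegularity.NavierStokesRegularity.Theorems.PoloidalWindowDoorLrcModEntireTwistingTHMassiveLiouville
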